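import Literature.AlgebraicGeometry.HodgeTheory.WeilClassesBlochSeed
import Literature.AlgebraicGeometry.Resolution.SmoothStalksRegular
import Literature.AlgebraicGeometry.Motives.GoodReductionSpecialFibreProofs
import HarnessLib

/-!
# Route `EightfoldBlochSeeds`, crux `BlochSeedDiscOne` (item stmt-HodgeConjecture-18881), line `birth`
# (`Cruxes/BlochSeedDiscOne/Lines/birth.lean` 814a6a70c14e831a), stub `stub_pad4_carrier` (l.205):
# the carrier sub-rung REDUCED to a smooth connected codimension-`4` presentation — the shape in which the
# DESIGN-32 degeneracy locus `Z = D₂₈(φ : 𝒪²⁹ → 𝓔′₃₂)` is delivered by Kleiman–Bertini and Fulton–Lazarsfeld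

HONEST FRAMING. Nothing here proves the stub, the crux, item 18881, rung H2, HC_AV, HC_CM or the Hodge conjecture;
nothing is constructed (no bundle, no map, no degeneracy scheme). UNCONDITIONAL `--supports` lemmas only (no named
fact taken as a hypothesis, no new definition, no Literature fact proposed — D-0026). Census-neutral.

WHAT IS HERE (leafhand `leafhand-hodge-blochseeddiscone-1-g0`, director-hodge g27 req-151 (2), CENSUS-FIRST REDUCTION with
DESIGN-32 — semihom-1 g45 §4.3/§5.1, g47 §0 (1): `𝓔′ = ⊕` of `32` ample globally generated line bundles on the PAD-4 anchor
`S⁴ = ((S × S) × S) × S`, `S = E₀ × E₀`, `Z := D₂₈(φ)` for a general `φ : 𝒪²⁹ → 𝓔′`, `[Z] = c₄(𝓔′) = q′·h⁴ − 3 072(e⁴ + ē⁴)`):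

* §1 **(L-int) DISCHARGED**: a scheme smooth over a field and connected is INTEGRAL (`isIntegral_of_smooth_of_connectedSpace`;
  Stacks 056S + 00NP: smooth ⟹ regular local rings ⟹ domains ⟹ reduced; Görtz–Wedhorn I Ex. 3.16: connected, locally
  Noetherian, domain stalks ⟹ irreducible) — assembled from the tree's `Resolution.isReduced_of_smooth`,
  `Resolution.isDomain_stalk_of_smooth`, `Motives.irreducibleSpace_of_isDomain_stalk`; and its closed-subscheme form
  `smoothConnectedIntegral`, whose TYPE is verbatim the body of the crux workfile's named law `SeedChecker.SmoothConnectedIntegral`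
  (`Cruxes/BlochSeedDiscOne/SeedCheckerHighTwist.lean` l.222, there «NEITHER PROVED NOR ASSERTED»): that law is now a theorem.
* §2 **THE CARRIER FROM A SMOOTH CONNECTED PRESENTATION** (`exists_lciCarrier_of_smooth_connected`): on any complex abelian
  variety `P`, a closed subscheme `i : Z ↪ P` which is a regular immersion of codimension `n`, SMOOTH over `ℂ`, CONNECTED, with
  every point of codimension `≥ n`, and on which `q·hⁿ + w` is supported, gives the body of the skeleton's `HasLciCarrierAt n P h w`
  (birth.lean l.171 = `HasBlochSeedAt` minus the semiregularity clause) — `IsIntegral Z` being supplied by §1; and the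
  STUB-SHAPED wrapper `exists_carrier_stubShape_of_smooth_connected` (general `(P, ψ, d)`; at `P := pad4Anchor E₀`,
  `ψ := pad4Action E₀ ψ₀`, `d := 1`, `n := 4` its conclusion is LITERALLY the statement of `stub_pad4_carrier`, the skeleton's
  abbreviations `symH`/`HasLciCarrierAt` unfolding by `rfl`).

WHAT IS NOT HERE = the census's remaining list (file `CENSUS-PAD4CARRIER-DESIGN32-leafhand-g0.md` of this hand): the three
inputs that would PRODUCE the hypotheses of §2 for DESIGN-32 are NOT in the tree by name — (L-Port) Thom–Porteous localisation
`[D₂₈(φ)] = c₄(𝓔′ − 𝒪²⁹)` ∕ «`c₄` supported on `D(φ)`» (Fulton, *Intersection Theory*, Thm. 14.4 (a)–(c); Eisenbud–Harris, *3264*,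
Thm. 12.4 and Lemma 5.2; typed only as the crux-workfile law `SeedChecker.PorteousFourLocalisation`, ranks `(a, a+3)`, here
`a = 29`), (L-BK-deg) Kleiman–Bertini for degeneracy loci of a general map to a globally generated bundle in characteristic `0`
(`D₂₇(φ) = ∅`, `D₂₈(φ)` smooth of pure codimension `4`: Kleiman 1974 Cor. 4 ∕ Hartshorne III Thm. 10.8 with Eisenbud–Harris
Lemma 5.2 (b); Fulton Ex. 14.3.2 (d)), (L-FL-deg) Fulton–Lazarsfeld connectedness of degeneracy loci (`𝓗om(𝒪²⁹, 𝓔′) = 𝓔′^{⊕29}`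
ample, `dim S⁴ = 8 > 4`: Fulton–Lazarsfeld, Acta Math. 146 (1981); Fulton–Pragacz LNM 1689 §9.2) — nor is the bundle `𝓔′`
with its Chern data constructed (the tree's Chern character `ChernCharacterBetti` is a hypothesis structure).

## References

[cite: StacksProject, Tag 056S and Tag 0357] [cite: GortzWedhorn2020, Exercise 3.16] [cite: Fulton1998, Thm. 14.4 and Example 14.3.2 (d)]
[cite: Bloch1972Semiregularity, Remark (7.5)]
-/

noncomputable section

-- single-problem summit (Problem = Summit): the mandated namespace repeats `HodgeConjecture`.
set_option linter.dupNamespace false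

open CategoryTheory AlgebraicGeometry
open Literature.AlgebraicGeometry Literature.AlgebraicGeometry.Motives Literature.AlgebraicGeometry.HodgeTheory
open Literature.AlgebraicTopology.SingularHomology

namespace Summit.HodgeConjecture.HodgeConjecture.Theorems

universe u

/-! ## §1 (L-int): smooth over a field and connected ⟹ integral -/

section Integral

/-- **A connected scheme smooth over a field is integral.** Smooth over `K` ⟹ every local ring is a regular local ring
(Stacks 056S), hence a domain (Stacks 00NP), so `Z` is reduced; `Z` is locally Noetherian (locally of finite type over a
field) and connected with domain stalks, hence irreducible (Görtz–Wedhorn I, Exercise 3.16; Stacks 0357). Assembled from the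
tree's `Resolution.isReduced_of_smooth`, `Resolution.isDomain_stalk_of_smooth` and `Motives.irreducibleSpace_of_isDomain_stalk`.
[cite: StacksProject, Tag 056S and Tag 0357] [cite: GortzWedhorn2020, Exercise 3.16] -/
theorem isIntegral_of_smooth_of_connectedSpace {K : Type u} [Field K] {Z : Scheme.{u}} (f : Z ⟶ Spec (CommRingCat.of K))
    [Smooth f] [ConnectedSpace Z] : AlgebraicGeometry.IsIntegral Z := by
  haveI : IsReduced Z := Resolution.isReduced_of_smooth f
  haveI : IsLocallyNoetherian Z := LocallyOfFiniteType.isLocallyNoetherian f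
  haveI : IrreducibleSpace Z :=
    Motives.irreducibleSpace_of_isDomain_stalk Z fun z => Resolution.isDomain_stalk_of_smooth f z
  exact isIntegral_of_irreducibleSpace_of_isReduced Z

/-- **(L-int) in closed-subscheme form**: a connected scheme `Z`, closed in a `ℂ`-scheme `X` and smooth over `ℂ` (through
`X → Spec ℂ`), is integral. The TYPE is verbatim the body of the crux workfile's named law `SmoothConnectedIntegral`
(`Cruxes/BlochSeedDiscOne/SeedCheckerHighTwist.lean`), which is thereby a theorem; the closed-immersion hypothesis is not
needed and is discarded. [cite: StacksProject, Tag 056S and Tag 0357] [cite: GortzWedhorn2020, Exercise 3.16] -/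
theorem smoothConnectedIntegral :
    ∀ (X : Motives.SchemeOver ℂ) ⦃Z : Scheme.{0}⦄ (i : Z ⟶ X.left), IsClosedImmersion i →
      AlgebraicGeometry.Smooth (i ≫ X.hom) → ConnectedSpace Z → AlgebraicGeometry.IsIntegral Z :=
  fun X _ i _ hsm _ =>
    haveI := hsm
    isIntegral_of_smooth_of_connectedSpace (i ≫ X.hom)

end Integral

/-! ## §2 The carrier sub-rung from a smooth connected codimension-`n` presentation -/

section Carrier

variable {n : ℕ} {P : AbelianVariety ℂ}

/-- **An lci carrier from a smooth connected presentation.** On a complex abelian variety `P`, let `i : Z ↪ P` be a regular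
immersion of codimension `n` (local complete intersection of constant codimension `n`) with `Z` SMOOTH over `ℂ` and CONNECTED,
every point of its image of codimension `≥ n` in `P`, and let `q·hⁿ + w` (`q ∈ ℚ`) be supported on the image. Then the body
of the skeleton's `HasLciCarrierAt n P h w` (`Cruxes/BlochSeedDiscOne/Lines/birth.lean` l.171: `HasBlochSeedAt` without the
Bloch-semiregularity clause) holds: `Z` is INTEGRAL by §1, the closed immersion is part of the regular immersion, the other
clauses pass through. This is the shape in which a degeneracy locus of a general map to a globally generated ample bundle is
delivered (Kleiman–Bertini: smooth of the expected codimension; Fulton–Lazarsfeld: connected) — neither of which is in the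
tree; see the module docstring. [cite: Bloch1972Semiregularity, Remark (7.5)] [cite: Fulton1998, Thm. 14.4 and Example 14.3.2 (d)] -/
theorem exists_lciCarrier_of_smooth_connected (h : complexBetti P.X 2) (w : complexBetti P.X (2 * n)) {Z : Scheme.{0}}
    (i : Z ⟶ P.X.left) (q : ℚ) (hreg : IsRegularImmersionOfCodim i n) (hsm : AlgebraicGeometry.Smooth (i ≫ P.X.hom))
    (hconn : ConnectedSpace Z) (hcoh : ∀ z ∈ Set.range i.base, (n : ℕ∞) ≤ Order.coheight z)
    (hsupp : ((q : ℚ) : ℂ) • cupPowTwo h n + w ∈ classesSupportedOn P.X (Set.range i.base) (2 * n)) :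
    ∃ (Z : Scheme.{0}) (i : Z ⟶ P.X.left) (q : ℚ),
      IsClosedImmersion i ∧ IsRegularImmersionOfCodim i n ∧ AlgebraicGeometry.IsIntegral Z ∧
      (∀ z ∈ Set.range i.base, (n : ℕ∞) ≤ Order.coheight z) ∧
      ((q : ℚ) : ℂ) • cupPowTwo h n + w ∈ classesSupportedOn P.X (Set.range i.base) (2 * n) :=
  ⟨Z, i, q, hreg.isClosedImmersion, hreg, smoothConnectedIntegral P.X i hreg.isClosedImmersion hsm hconn, hcoh, hsupp⟩

/-- **The carrier stub's statement from a smooth connected presentation (stub shape, general `(P, ψ, d)`).** For a complex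
abelian variety `P` with an endomorphism `ψ`, a projective embedding `e` with a rational `a ≠ 0`, a NON-ZERO RATIONAL class `w`
of the Weil plane `weilClassesOf P ψ n d`, and a smooth connected codimension-`n` presentation `i : Z ↪ P` (as in
`exists_lciCarrier_of_smooth_connected`) supporting `q·h_Kⁿ + w` for the `K`-symmetrised class
`h_K = d·e^*a + ψ^*e^*a`, the conjunction «`∃ e a w`, `a` rational `≠ 0`, `w ∈` Weil plane rational `≠ 0`, lci carrier of
`q·h_Kⁿ + w`» holds. At `P := pad4Anchor E₀`, `ψ := pad4Action E₀ ψ₀`, `n := 4`, `d := 1` the conclusion is LITERALLY the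
statement of `stub_pad4_carrier E₀ ψ₀ hE hψ` (birth.lean l.205; `symH` and `HasLciCarrierAt` unfold by `rfl`), so the stub
follows by `exact` from the DESIGN-32 data once (L-Port), (L-BK-deg), (L-FL-deg) and the bundle `𝓔′` are supplied — none of
which is claimed here. [cite: Bloch1972Semiregularity, Remark (7.5)] [cite: Fulton1998, Thm. 14.4 and Example 14.3.2 (d)] -/
theorem exists_carrier_stubShape_of_smooth_connected (ψ : P ⟶ P) (d : ℕ) (e : ProjectiveEmbedding P.X)
    (a : complexBetti (projectiveSpace e.n ℂ) 2) (w : complexBetti P.X (2 * n)) (ha : IsRationalClass a) (ha0 : a ≠ 0)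
    (hwW : w ∈ weilClassesOf P ψ n d) (hwr : IsRationalClass w) (hw0 : w ≠ 0) {Z : Scheme.{0}} (i : Z ⟶ P.X.left)
    (q : ℚ) (hreg : IsRegularImmersionOfCodim i n) (hsm : AlgebraicGeometry.Smooth (i ≫ P.X.hom))
    (hconn : ConnectedSpace Z) (hcoh : ∀ z ∈ Set.range i.base, (n : ℕ∞) ≤ Order.coheight z)
    (hsupp : ((q : ℚ) : ℂ) •
        cupPowTwo ((d : ℂ) • complexBetti.map e.ι 2 a + complexBetti.map ψ.hom.hom.hom 2 (complexBetti.map e.ι 2 a)) n +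
        w ∈ classesSupportedOn P.X (Set.range i.base) (2 * n)) :
    ∃ (e : ProjectiveEmbedding P.X) (a : complexBetti (projectiveSpace e.n ℂ) 2) (w : complexBetti P.X (2 * n)),
      IsRationalClass a ∧ a ≠ 0 ∧
      w ∈ weilClassesOf P ψ n d ∧ IsRationalClass w ∧ w ≠ 0 ∧
      ∃ (Z : Scheme.{0}) (i : Z ⟶ P.X.left) (q : ℚ),
        IsClosedImmersion i ∧ IsRegularImmersionOfCodim i n ∧ AlgebraicGeometry.IsIntegral Z ∧
        (∀ z ∈ Set.range i.base, (n : ℕ∞) ≤ Order.coheight z) ∧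
        ((q : ℚ) : ℂ) •
            cupPowTwo ((d : ℂ) • complexBetti.map e.ι 2 a + complexBetti.map ψ.hom.hom.hom 2 (complexBetti.map e.ι 2 a)) n +
            w ∈ classesSupportedOn P.X (Set.range i.base) (2 * n) :=
  ⟨e, a, w, ha, ha0, hwW, hwr, hw0, exists_lciCarrier_of_smooth_connected _ w i q hreg hsm hconn hcoh hsupp⟩

end Carrier

end Summit.HodgeConjecture.HodgeConjecture.Theorems

end
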